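import Summits.SmoothPoincare4.SmoothPoincare4.Theses.SymplecticOrigami
import Summits.SmoothPoincare4.SmoothPoincare4.Theses.AlgebraicDegree
import Summits.SmoothPoincare4.SmoothPoincare4.Theses.EuclideanOrigami
import Summits.SmoothPoincare4.SmoothPoincare4.Theorems.OrigamiFoldExistence.Negative.ZeroSlack
import Summits.SmoothPoincare4.SmoothPoincare4.Theorems.SymplecticOrigamiOrigamiFoldExistenceShadowPleatsDefs
import Summits.SmoothPoincare4.SmoothPoincare4.Theorems.SymplecticOrigamiOrigamiFoldExistenceShadowPleatsTransport
import Summits.SmoothPoincare4.SmoothPoincare4.Theorems.SymplecticOrigamiOrigamiFoldExistenceShadowPleatsCleanDefs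
import Summits.SmoothPoincare4.SmoothPoincare4.Theorems.SymplecticOrigamiOrigamiFoldExistenceStubRoundRimNormalForm
import Summits.SmoothPoincare4.SmoothPoincare4.Theorems.SymplecticOrigamiOrigamiFoldExistenceStubPleatFreeStandard
import Summits.SmoothPoincare4.SmoothPoincare4.Theorems.SymplecticOrigamiOrigamiFoldExistenceShadowPleatsOuterCleanDefs
import Summits.SmoothPoincare4.SmoothPoincare4.Theorems.SymplecticOrigamiOrigamiFoldExistenceStubOuterCleanRecognitionGlue
import Summits.SmoothPoincare4.SmoothPoincare4.Theorems.SymplecticOrigamiOrigamiFoldExistenceStubOuterCleanRecognitionReduction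
import Summits.SmoothPoincare4.SmoothPoincare4.Theorems.SymplecticOrigamiOrigamiFoldExistenceStubOuterCleanRecognitionChartSide
import Summits.SmoothPoincare4.SmoothPoincare4.Theorems.SymplecticOrigamiOrigamiFoldExistenceStubCleanOnePleatIroning
import Summits.SmoothPoincare4.SmoothPoincare4.Theorems.SymplecticOrigamiOrigamiFoldExistenceStubOuterSideLemma
import Summits.SmoothPoincare4.SmoothPoincare4.Theorems.SymplecticOrigamiOrigamiFoldExistenceStubOuterCleanRecognitionOfSide
import Literature.Topology.Immersions.WrinkledEmbeddingsRoundCollarAssembly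
import Literature.Topology.Immersions.GaussMapDegreeEuler
import Literature.Topology.FourManifolds.HomotopySpheres
import Literature.Topology.FourManifolds.HomotopyS4CompactProofs
import Literature.Topology.FourManifolds.HomotopyS4OrientableProofs

/-!
# Skeleton line `shadow-pleats` for crux `OrigamiFoldExistence` (stmt-SmoothPoincare4-7844)

Route `SymplecticOrigami`, crux r4 `OrigamiFoldExistence` (E; ZERO SLACK: kernel-checked both ways,
`Disproof.lean` §2 / `Negative.ZeroSlack`, so every line for E is a line for `Σ ≅ S⁴` followed by
transport of the round sphere's fold data).  Idea card `Ideas/shadow-pleats.md` (crux-ideate r1,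
ideator 2); triage r1-2 PASS (with doubt) + r1-3 PASS, three sharpenings, all adopted below.

THE LINE.  Read the fold data EXTRINSICALLY.  Every homotopy 4-sphere `Σ` embeds in
`ℝ⁵ = ℂ² × ℝ` (`Θ₄ = 0`), and for `Σ ⊂ ℂ² × ℝ` the SHADOW MAP `φ = proj5 ∘ ι : Σ → ℝ⁴` (forget the
height `h = p 4`) is an equidimensional map whose singular set is the locus of VERTICAL TANGENCY of
`Σ`; on the round `S⁴` it is the fold along the equator, and `φ*ω₀` is Cannas da Silva–Guillemin–
Pires' origami form (arXiv:0909.4065 Ex. 2.3, tree `sphereOrigamiForm`).  Put a chart ball of `Σ` in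
ROUND position: `ι(Σ) ∩ {h ≤ 1 - δ} = S⁴ ∩ {h ≤ 1 - δ}` (the whole round sphere except a polar cap,
so the equatorial fold and the lower sheet are standard and the fake 4-disc `Δ = ι⁻¹{h ≥ 1 - δ}`
hangs above the plane `h = 1 - δ`, attached along the polar circle where the sphere is graphical).
Eliashberg–Mishachev's h-principle for EMBEDDINGS INTO FOLIATIONS (arXiv:1108.1265 =
doi:10.1090/conm/498/09753, Thm 3.2 with Remark 2 (relative) and the final Remark of §3.2 (double-fold
version via Thm 2.10 "int-tang-global-folds"), codimension `q = 4 ≤ n = 4`, foliation of `ℝ⁵` by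
vertical lines) then isotopes `Δ` rel its collar, `C⁰`-small, to a position whose only vertical
tangencies are FOLDS along finitely many pairs of 3-spheres bounding annuli `S³ × I` — PLEATS
(spherical double folds) — each born from an embryo at a point (ibid. §3.2 D(b)), hence with
STANDARD annulus and STANDARD hole inside a chart ball.  The formal hypothesis of the h-principle is
the vanishing of the relative Gauss degree of `Δ` into `(S⁴, open upper hemisphere)`, which is
`deg G_Σ − deg G_cap = χ(Σ)/2 − 1 = 0` for EVERY `Σ` (triage r1-2/r1-3 re-derived it).  So every
`Σ` has a PLEATED ROUND-RIM POSITION with some number `k` of pleats (`stub_roundRimNormalForm`), and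
the least such `k` is the PLEAT NUMBER `p(Σ)`.  The ladder: `p = 0 ⇒ Σ ≅ S⁴` by sheet counting and an
explicit graph-straightening diffeomorphism, no Cerf (`stub_pleatFreeStandard`); `p = 1 ⇒ p = 0`
(ONE-PLEAT IRONING — from r3 on in two steps: UN-THREADING of one pleat to a CLEAN one,
`stub_onePleatUnthreading`, then CLEAN IRONING, `stub_cleanOnePleatIroning`; from r4 on the whole ladder is
NORMALISATION `stub_pleatNormalisation` + RECOGNITION of clean positions, see LEAD LOG r4); `p = 2 ⇒ p ≤ 1` (UN-THREADING two pleats, the card's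
first honest rung K1, `stub_twoPleatUnthreading`); and PLEAT COLLAPSE `p ≤ 2` for every `Σ`
(`stub_pleatCollapse`, the card's K2 — the zero-slack carrier of this line, HARDEST).  Step zero,
`Σ ↪ ℝ⁵`, is VERBATIM the support item `EmbedsInR5` of route AlgebraicDegree (stmt-SmoothPoincare4-3403),
so it is staffed once (`stub_embedsInR5`).

`OrigamiFoldExistence_of` composes the six stubs with the LANDED transport lemma
`Negative.foldData_transport` (p72874) and the route's own support item `RoundSphereIsOrigamiFold`
(by name, hypothesis `hR`, exactly as in `Lines/round-trace-continuity.lean`) into the crux BY NAME;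
kernel-checked, no `sorry` outside the six `stub_*`; the packaging "homotopy S⁴ ⇒ compact /
orientable" is the PROVED pair `compactSpace_of_homotopyEquiv_sphere_four_holds`,
`isOrientable_of_homotopyEquiv_sphere_four_holds`.

TYPING (all over Mathlib; no new objects are posited).  A pleated position is the predicate
`IsPleatedPosition ι δ e`: `ι : M → ℝ⁵` a `C^∞` embedding; `0 < δ < 1` and
`range ι ∩ {h ≤ 1 - δ} = S⁴ ∩ {h ≤ 1 - δ}` (round part, containing the equatorial fold); `k` PLEAT
CHARTS `e j : ℝ⁴ ↪ M` (smooth embeddings of the whole model space) landing strictly above the plane,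
whose FOLD SPHERES are the round spheres of radii 1 and 2 of the chart — so the annulus
`e j {1 ≤ |u| ≤ 2} ≅ S³ × I` and the hole `e j {|u| < 1} ≅ B⁴` are standard BY CONSTRUCTION (triage
r1-2 "define p over STANDARD pleats", r1-3 sharpen (2) "source annulus ≅ S³ × I"; this is what
excludes the doubles `D(B) = Σ_B # Σ̄_B` of Schoenflies balls from the one-pleat rung); fold spheres
of distinct pleats are disjoint (NESTING inside another pleat's annulus or hole is allowed, as E–M
produce it); the shadow `proj5 ∘ ι` is an immersion at every point above the plane off the fold
spheres; and at each fold-sphere point the shadow has a FOLD: `IsFoldPointAt G u` = corank-1 point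
of `G = proj5 ∘ ι ∘ e j : ℝ⁴ → ℝ⁴` whose intrinsic second derivative `ker × ker → coker` is non-zero
(Whitney; for the shadow of a hypersurface this is `II(∂_h, ∂_h) ≠ 0`: the vertical tangent is not
asymptotic), written with `fderiv` in the pleat chart, where it is coordinate-free.  The spun
shadows `{h² = f(x)}` of the card's `SpunShadowStandard` are the `k = 0` positions up to the
graph-straightening of `stub_pleatFreeStandard` (triage r1-3 sharpen (1), `0 < f` on the open ball,
is moot: no defining function is quantified any more).  NON-VACUITY of the fold clause is PROVED in
this file (`ModelFold.isFoldPointAt_modelFold`, sorry-free): Whitney's model fold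
`u ↦ (u₀², u₁, u₂, u₃)` satisfies `IsFoldPointAt` at the origin (kernel `e₀`,
`D²G(0)[e₀,e₀] = 2e₀ ∉ range dG(0)`); the 0-pleat position of the round sphere is recorded as the
statement `RoundSphereIsPleatFree` for refuters.

Disproof used (Disproof.lean v3, read 2026-08-16): §1 LOAD-BEARING — any proof must use `M ≃ₕ S⁴`
including CONNECTEDNESS (`crux_false_without_homotopyEquiv`, `Negative.LoadBearing` p73838,
`Negative.Disconnected` p74343): this line uses compactness + connectedness of `M` at
`stub_pleatFreeStandard` (properness of the glued shadow map and triviality of the covering it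
defines) and `H₃(Δ) = 0`, `χ(Σ) = 2` at `stub_roundRimNormalForm` (fold spheres separate; Gauss
degree); §2 ZERO SLACK — honoured: the line ends in `Negative.foldData_transport` (landed) exactly as
§2 prescribes, and its zero-slack step is NAMED (`stub_pleatCollapse`); §4 no refuted strengthening
bears on pleats; §7 targets are the other line's stubs.  `ledger negatives --problem SmoothPoincare4`
= 0; no landed `Negative/` lemma refutes an instance of any stub (the three landed ones are
`ZeroSlack`, `LoadBearing`, `Disconnected`, all imported or importable here).

LEAD LOG (line lead seat 1, prover-line-stmt-SmoothPoincare4-7844-1, from 2026-08-16T10:13Z; PICKED.md).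
* r1 (this revision): the six `stub_*` STATEMENTS have the local notations `E4`/`E5`/`𝕊⁴` expanded
  (a Theorems stub file restates the registered signature textually and cannot rely on this file's
  notation); terms unchanged (each named `Prop` still closes by `exact stub_…`).  The vocabulary
  (`proj5`, `pleatSpheres`, `IsFoldPointAt`, `IsPleatedPosition`, `HasPleatedPosition`, the two
  non-vacuity certificates) is proposed verbatim as
  `Theorems/SymplecticOrigamiOrigamiFoldExistenceShadowPleatsDefs.lean`
  (namespace `…Theorems.OrigamiFoldExistence.ShadowPleats`); once it is built on the farm this file
  imports it and drops its local copies (r2), so skeleton, stub files and disprover share ONE definition.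
  Disproof.lean v6.1 re-read (§7c pre-screen of these six stubs: no junk; (α) one-pleat SHADOWS are soft,
  (γ)/(γ') deletion lemma proves S5 for clean pleats, (δ) threading forced / bench `(S²×S²)#(S¹×S³)`;
  §7b Kervaire test: the line's `π₁`-content must sit in S3/S4).
* r2: the vocabulary now LIVES IN THE TREE — `Theorems/SymplecticOrigamiOrigamiFoldExistenceShadowPleatsDefs.lean`
  (p96059 ACCEPTED; namespace `…Theorems.OrigamiFoldExistence.ShadowPleats`, opened below): the local copies of
  `proj5`/`pleatSpheres`/`IsFoldPointAt`/`IsPleatedPosition`/`HasPleatedPosition` and of the two certificates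
  are deleted (k = 0 sanity = `hasPleatedPosition_sphere_zero`, fold non-vacuity =
  `ModelFold.isFoldPointAt_modelFold`, both kernel theorems there; k ≥ 1 joint satisfiability of the fold +
  immersivity clauses by ONE chart of an embedded hypersurface = `exists_modelPleatChart`, p97552, S3 worker).
  STUB 1 is no longer a stub: it IS the route item `Summit.SmoothPoincare4.SmoothPoincare4.Theses.AlgebraicDegree.EmbedsInR5`
  (stmt-SmoothPoincare4-3403, verbatim), taken BY NAME as hypothesis `h1` of `OrigamiFoldExistence_of`
  exactly as `RoundSphereIsOrigamiFold` enters as `hR` (same device as seat 0's `CerfGammaFour`).  Zero slack of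
  S3 is now kernel-certified for this line: `…Theorems.….ShadowPleats.stub_pleatCollapse_of_smoothPoincare4 :
  SmoothPoincare4 → S3 verbatim` (Transport file, p96867, S3 worker: `stub-blocked: SmoothPoincare4`).
  S6 `stub_pleatFreeStandard` is PROVED in the lead's folder (work/stubs/stub_pleatFreeStandard.lean, 1320 lines,
  rc 0, axioms {propext, Classical.choice, Quot.sound}); it lands as four files
  `…StubPleatFreeStandard{Shadow,Seam,Sheets,}.lean` (file I = p98323 in review) and r3 will close its `sorry`.
LEAD LOG (line lead seat c3, prover-line-stmt-SmoothPoincare4-7844-c3-0, registry inherited 2026-08-16T13:25Z; PICKED.md).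
* r3 (this revision): seat 1 fell silent at the gate after p100895 (11:56Z) with S6 parts I–III landed
  (`…StubPleatFreeStandard{Shadow,Seam,Sheets}.lean` = p98323/p99703/p100269: `polarLift`/`straighten`/IFT, shadow a
  local diffeo at positive height + seam lemmas, maximum principle + sheet count `existsUnique_preimage`) but file IV
  and its announced reshape unregistered; seat c2 published `W-Morse-analysis-c2.md` v4.1 (filling `W⁵` + boundary
  Morse theory) and stopped 12:37Z.  RESHAPE (the one seat 1's wave 1 asked for — S4/S5 `stub-misstated` over WILD
  pleats — in the form of c2's R8): S5 `stub_onePleatIroning` is SPLIT into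
  S5b `stub_onePleatUnthreading : M ≃ₕ S⁴ → HasPleatedPosition M 1 → ∃ k ≤ 1, HasCleanPleatedPosition M k`
  (OPEN — self-unthreading of ONE pleat, c2 §6: the annulus shadow made injective, or the pleat removed; held by the
  lead on paper: equal-type pairs, the limaçon pleat, mutual blocks) and
  S5a `stub_cleanOnePleatIroning : M ≃ₕ S⁴ → HasCleanPleatedPosition M 1 → HasPleatedPosition M 0`
  (TRUE on paper twice: Disproof §7c (γ)+(γ') deletion by cut-and-paste — only a fold can thread a pocket — and c2's
  vertical-rearrangement criterion R4/R5 via `W ≅ B⁵ ∪ handles`; XL in Lean), both over the LANDED clean vocabulary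
  `IsCleanPleat` / `HasCleanPleatedPosition` (`…ShadowPleatsCleanDefs.lean`, p100895, certificate
  `isCleanPleat_zigzagModel`).  S2, S3, S4, S6 keep their registered signatures byte-for-byte (S4's wave-1 verdict is
  re-read as "open for wild or mutually threaded pleats": two clean pleats can thread each other, so cleanness alone
  isolates no true sub-statement of S4 beyond the deletion lemma, which S5a carries).  Composition unchanged in
  shape: S2 → S3 → S4 → S5b → (k = 0: S6 | k = 1: S5a → S6).  WAVE of this cycle: S6 file IV (assembly:
  `straighten` is a bijective local diffeomorphism onto `S⁴`), S2 CONDITIONAL on the three named facts of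
  `Literature/Topology/Immersions/WrinkledEmbeddingsRoundCollar.lean` (p98391; glue by `rfl` of the vocabularies),
  S5a honest attempt, S3/S4 certificates; S5b with the lead.
* r4 (wave 1 of seat c3 integrated, 2026-08-16T15:40Z).  LANDED: S6 `stub_pleatFreeStandard` is a TREE THEOREM
  (`…StubPleatFreeStandard.lean`, p107118: `straighten` is a bijective local diffeomorphism onto `S⁴`) — its `sorry`
  is gone, the name below now denotes the tree theorem; S2 is DISCHARGED modulo three NAMED LITERATURE FACTS
  (`…StubRoundRimNormalForm.lean`, p107172: `stub_roundRimNormalForm_of_facts hEM hRP hTR`, the facts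
  `EliashbergMishachev2009_doubleFolds_of_hasTransversalRotation` (E–M 2009 Thm 3.2, double-fold/relative/C⁰-small,
  vertical foliation), `exists_isSmoothEmbedding_roundPart` (Kosinski VI), `hasTransversalRotation_of_homotopyEquiv_sphere_four`
  (Hopf/Guillemin–Pollack) of `Literature/Topology/Immersions/WrinkledEmbeddingsRoundCollar.lean`, p98391, entering
  `OrigamiFoldExistence_of` BY NAME as `EmbedsInR5`/`RoundSphereIsOrigamiFold` do); S5a reduced in the kernel to ONE
  named geometric ingredient `CleanPleatIroningChart` (S5a worker: helper files `…StubCleanOnePleatIroning{Vertical,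
  Patch,FoldKernel,SeamSheet}.lean` = p107877/p108215/p108609/p108972 landed; `…Deletion` (the deletion lemma (γ) in
  kernel form `hasPleatedPosition_zero_of_patch`, `cleanOnePleatIroning_of_ironingChart`) and `…Radial`
  (`smoothIsotopy_radial`) resubmitted as p111295/p111386 after a gate restart).  RESHAPE (S4 worker's THEOREM C,
  evidence `stub_twoPleatUnthreading.md` v2 attached 14:28Z, re-derived by the lead: in ANY all-clean position the
  degree count `n_P = 1_B − Σ_j 1_{U_out^j} ≥ 0` makes the chimney shadows disjoint balls in `B`, the outer sheet
  shadow-EMBEDDED and the charts un-nested, so `HasCleanPleatedPosition M k ⇒ M ≅ S⁴` for EVERY closed connected `M`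
  and EVERY `k` — mutual threading of clean charts is invisible; S3 worker: `stub-blocked: SmoothPoincare4`, bench =
  Kervaire's `M_K`).  Consequently the clean/wild split, not the pleat NUMBER, separates theorem from open problem,
  and the ladder is re-typed as RECOGNITION (TRUE) + NORMALISATION (OPEN, the named zero-slack carrier):
    S3' `stub_pleatNormalisation : M ≃ₕ S⁴ → ∀ k, HasPleatedPosition M k → ∃ k' ≤ 2, HasCleanPleatedPosition M k'`
        (OPEN; absorbs S3 `stub_pleatCollapse`, S4b and S5b `stub_onePleatUnthreading`; ⟺ SPC4 given S2 and
        recognition: an exotic `Σ` has pleated positions by S2 and no clean one by Theorem C; kernel certificate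
        `SmoothPoincare4 → S3'` to be landed as `…ShadowPleatsNormalisationCert.lean`; mechanism = un-SELF-threading of
        wild charts (c2 §6 retreat calculus) + un-NESTING (c2 7.5 (b) transplanting); benches `N = (S²×S²)#(S¹×S³)`
        (no all-clean position for any `k`) and `M_K`),
    S4a `stub_cleanTwoPleatIroning : M ≃ₕ S⁴ → HasCleanPleatedPosition M 2 → HasPleatedPosition M 0` (TRUE = Theorem C
        at `k = 2`; XL Lean: degree of proper maps / Alexander duality in `ℝ⁴` / collars),
    S5a `stub_cleanOnePleatIroning` (unchanged; TRUE; kernel-reduced to `CleanPleatIroningChart`),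
    S6  (tree theorem).
  Composition: S1 (`EmbedsInR5`) → S2 (facts) → S3' → {k'=0: S6 | k'=1: S5a → S6 | k'=2: S4a → S6} → transport.
  Sorries 6 → 3 (S3' open; S4a, S5a true).  Retired registered names: `stub_pleatCollapse`, `stub_twoPleatUnthreading`,
  `stub_onePleatUnthreading` (their content is S3'; S4's registered conclusion `∃ k ≤ 1, HasPleatedPosition M k` with wild
  charts allowed had ALL its content in wild/nested charts, Theorem C).
* r5 (lead's OUTER-CLEAN RECOGNITION theorem, 2026-08-16T16:10Z; crux workfile `OuterClean-analysis-c3.md`, evidence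
  attached 16:06Z).  (O1) SIDE LEMMA: for an innermost chart whose OUTER crease `c_out = proj5 ι e(S(0,2))` is EMBEDDED,
  the two germs born at `c_out` lie on its UNBOUNDED side — by the normal degree of the regular homotopy
  `s ↦ proj5 ι e(s·)` (`1 ≤ s ≤ 2`, fold-free shell, immersed creases) compared at its two ends through Hopf's theorem
  for the immersed hole ball (`deg = ±1`) and for the region `Ū_out` (`χ = 1`); (O2) STRUCTURE: un-nested + all outer
  creases embedded (`HasOuterCleanPleatedPosition`, vocabulary `…ShadowPleatsOuterCleanDefs.lean` p113294 in review —
  LOCAL copies below until it lands) ⇒ `n_P = 1_B − Σ 1_{U_out^j}`, chimneys `Ū_out^j` pairwise disjoint in `B_ρ`, outer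
  sheet shadow-EMBEDDED, `M ≅ (S⁴ ∖ ⋃ U_out^j) ∪ k standard balls`; (O3) `k = 1`: `M` = Schoenflies ball ∪ `B⁴`,
  `M ≅ S⁴ ⟺ Ū_out ≅ B̄⁴` (Palais/Cerf), punctured `M` embeds in `S⁴` (cruxes `EuclideanOrigami.PuncturedEmbeds`
  stmt-7485 / `SchsplitPuncturedEmbeds` stmt-0371 for such `M`); `Schoenflies ∧ Γ₄ = 0 ⇒ M ≅ S⁴`.  RESHAPE: the open stub
  is WEAKENED from NORMALISATION (clean; ⟺ SPC4) to
    S3'' `stub_outerNormalisation : M ≃ₕ S⁴ → ∀ k, HasPleatedPosition M k → ∃ k' ≤ 1, HasOuterCleanPleatedPosition M k'`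
         (OPEN; slack NOT provably zero: `SmoothPoincare4 ⇒` it by transport, it `⇒ PuncturedEmbeds`, and it
         `∧ Schoenflies ∧ Γ₄=0 ⇒ SmoothPoincare4`; so inside this line SPC4 factors as OUTER-NORM ∧ SCHOENFLIES; whether
         the slack is positive is the REALISABILITY question (R) of the analysis note — do Schoenflies spheres `X ∪ B⁴`
         admit outer-clean 1-pleat positions? = a monotone-sweep immersion problem for `S³×[1,2] → ℝ⁴` rel both ends +
         a lifting problem — handed to the disprover),
    S4'' `stub_outerCleanRecognition : EuclideanOrigami.Schoenflies → CerfGammaFour → M ≃ₕ S⁴ →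
         HasOuterCleanPleatedPosition M 1 → Nonempty (M ≃ₘ S⁴)` (TRUE on paper = O2 + O3 with the two route items BY NAME,
         exactly as `EmbedsInR5` / `RoundSphereIsOrigamiFold` enter; XL Lean, same ingredients as the S5a roadmap),
    S5a  `stub_cleanOnePleatIroning` kept (TRUE unconditionally; kernel-reduced to `CleanPleatIroningChart`) as the witness
         that the Schoenflies input is consumed only by NON-clean outer-clean positions (off the main path, feeds
         `nonempty_diffeomorph_of_clean_one`); S4a `stub_cleanTwoPleatIroning` and S3' `stub_pleatNormalisation` RETIRED
         (S3' keeps its landed certificate p113474 as the record that the clean form is SPC4-equivalent).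
  Composition: S1 (`EmbedsInR5`) → S2 (facts) → S3'' → {k'=0: S6 | k'=1: S4'' (+ `Schoenflies`, `CerfGammaFour`)} → transport.
  Sorries: 3 (S3'' open; S4'', S5a true).  Benches: `M_K`, `N` have NO un-nested outer-clean position for any `k` (O2's
  output is simply connected) — sharper than "no all-clean position".  (Registered with a fourth stub,
  `stub_wrinkledEmbeddingFacts` = F1 ∧ F2 ∧ F3, because the skeleton check admits only named stubs / obligations as
  hypotheses of `OrigamiFoldExistence_of`.)
* r6 (wave 2 of seat c3 integrated, 2026-08-16T19:00Z).  LANDED: S5a `stub_cleanOnePleatIroning` is a TREE THEOREM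
  (`…StubCleanOnePleatIroning.lean`, p120755: the S5a continuation worker PROVED `CleanPleatIroningChart` outright —
  helper files `…{Orient,Signs,Side,Inverse,Straighten,Crease,Sheets}.lean` = p115638/p116209/p119598/p119623/p119678/
  p119832/p117221+p120041 over wave 1's `…{Vertical,Patch,FoldKernel,SeamSheet,Deletion,Radial}`), so with S6 the CLEAN
  one-chart rung `HasCleanPleatedPosition M 1 → M ≅ S⁴` is kernel-closed with NO Schoenflies and NO Cerf; S4'' is
  kernel-REDUCED to ONE ingredient `OuterCleanRecognitionChart` (S4'' worker: glue `nonempty_diffeomorph_of_chartComplement`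
  — lifted outer crease is a smooth `S³ ↪ S⁴`, Schoenflies in ball form, side argument `eq_compl_of_frontier`, two-disc
  cover, Cerf — `…StubOuterCleanRecognitionGlue.lean` p118158; reduction `outerCleanRecognition_of_chart`,
  `…StubOuterCleanRecognitionReduction.lean` p120886), and the worker's ADVERSARIAL AUDIT CONFIRMS the side lemma O1
  (all four signs re-derived independently, incl. the orientation-reversing chart and the mushroom; O2 at `k = 1` needs
  no general position; evidence `stub_outerCleanRecognition.md` §A); of the literature debt F1 ∧ F2 ∧ F3, F2 is the tree
  theorem `exists_isSmoothEmbedding_roundPart_holds` (`…WrinkledEmbeddingsRoundCollarRoundPart.lean`) and F3 the tree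
  theorem `hasTransversalRotation_of_homotopyEquiv_sphere_four_holds` (`…GaussMapDegreeEuler.lean`: Hopf's degree
  theorem + curvatura integra, facts seats), leaving F1 = Eliashberg–Mishachev's engine (S2-facts worker, assessment
  `stub_wrinkledEmbeddingFacts.md`; assembly `wrinkledEmbeddingFacts_of_doubleFolds_of_hasTransversalRotation`,
  `…Assembly.lean` p115543).  RESHAPE (names only; statements of S3''/S4'' unchanged): the debt stub shrinks to
  `stub_eliashbergMishachev2009 : EliashbergMishachev2009_doubleFolds_of_hasTransversalRotation` (F1 alone), S4'' becomes
  `stub_outerCleanRecognitionChart : OuterCleanRecognitionChart` (the ingredient by name; S4'' itself is then the tree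
  reduction), the outer-clean vocabulary is IMPORTED (`…ShadowPleatsOuterCleanDefs.lean`, p113294) and the local copies
  are gone.  Stubs: F1 (literature debt, XL) | S3'' `stub_outerNormalisation` (OPEN, slack ≤ Schoenflies) |
  `stub_outerCleanRecognitionChart` (TRUE on paper = O1 + O2; XL Lean: Hopf degree for the side lemma, sheet count with a
  wild inner crease, collars — the clean-case toolkit of S5a's eleven files is the template).  Sorries: 3.
LEAD LOG (line lead seat c4, prover-line-stmt-SmoothPoincare4-7844-c4-0, registry inherited 2026-08-16T21:10Z; PICKED.md).
* r7 (this revision).  Seat c3 ended (~20:50Z) inside its wave 3, whose S4''-chart worker had LANDED the helper files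
  `…StubOuterCleanRecognitionChart{Chimney,Tube,Shells,Shell,Ray,Collar,Side,Sheets,SeamRule,CreaseRule,CapProfile}.lean`
  (A–I, M: p122689 … p124823 — lifted chimney from the tree's Jordan–Brouwer side package; tube coordinates and the
  angular straightening near the outer fold sphere; monotone fibre heights ⇒ thin-collar injectivity, one-sidedness,
  local surjectivity; the SIDE LEMMA O1 stated as the named `OuterSideLemma : Prop` and `CollarData`; the sheet-count
  frame `sheet0/1/2` with the seam and crease rules; the radial profile of the cap map), left files J (`…Claim`, p124679)
  and N (`…CapMap`, p125831) PENDING at the gate, and files K/L/O only REGISTERED (`sheet_count`, `injOn_shadow_outerPartK`,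
  `injective_mfderiv_capMap`).  This revision (i) IMPORTS the tree theorems the r6 text still copied locally: S5a
  `stub_cleanOnePleatIroning` (p120755) and the S4'' reduction `outerCleanRecognition_of_chart` (p120886) — the interim
  copies are deleted; (ii) SPLITS the chart stub HONESTLY along the line its worker had already drawn in the tree:
    O1   `stub_outerSideLemma : OuterSideLemma` (file F `…ChartSide`; PAPER THEOREM — the lead's side lemma, audited by two
         workers; formal debt = degree theory for maps `S³ → S³` and Hopf's `deg Gauss = χ`, absent from Mathlib; named so
         that it can be discharged independently, exactly as `CerfGammaFour` is),
    S4''c `stub_outerCleanRecognitionChartOfSide : OuterSideLemma → OuterCleanRecognitionChart` (TRUE; the in-flight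
         construction: sheet count `n_P = 1_{B_ρ} − 1_U` from the seam/crease rules ⇒ the shadow embeds the closed outer part
         onto `B̄_ρ ∖ U`; the cap map sweeps the round part once over `S⁴ ∖ λ(B_ρ)`; the structure map `Ψ` (`λ ∘ shadow` above,
         cap map below) is an injective immersion OFF the fold sphere; across the lifted crease `Φ` is NOT `Ψ⁻¹` but a
         FIBREWISE smooth re-parametrisation of the fold collar in the straightened tube coordinates; smooth extension into the
         chimney through the chart by a cut-off),
  so that `stub_outerCleanRecognitionChart` (r6) is retired as a registered name (its landed helpers stay as supports) and the
  line's kernel endpoint reads  `E ⇐ F1 ∧ S3'' ∧ O1 ∧ Schoenflies ∧ Γ₄ = 0 ∧ EmbedsInR5 ∧ RS`  with every other step a tree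
  theorem once S4''c lands.  Statements of F1 and S3'' byte-identical.  Stubs: F1 (literature debt) | S3'' (OPEN, slack ≤
  Schoenflies; SPC4-hardness = the lifting question (R2) of `OuterClean-analysis-c3.md` §8) | O1 (paper theorem, degree
  theory) | S4''c (TRUE, waves of this seat).  Sorries: 4 (3 once S4''c lands).
* r8 (same hour; design pass before the first wave).  The construction stub is RE-TARGETED from the radius-`2` ingredient
  `OuterCleanRecognitionChart` (which demands a smooth immersion `Φ` ACROSS the lifted fold crease, where `Ψ = λ ∘ shadow`
  folds and `Ψ⁻¹` is only continuous) to S4'' ITSELF: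
    S4''σ `stub_outerCleanRecognitionOfSide : OuterSideLemma → (S4'' verbatim)`,
  proved by CUTTING AT RADIUS `R ∈ (2 + κ/2, 2 + κ)` inside the fold-free thin collar: the glue
  `nonempty_diffeomorph_of_chartComplement` (p118158) is generic in the chart and the crease, the rescaled chart
  `e 0 ∘ (R/2 ·)` has the embedded immersed sphere `G(S_R)` as its "crease", `Ψ` is a local diffeomorphism across it, and the
  fold crease disappears inside the lifted cut region `U_R = chimney ∪ λ(G({2 ≤ ‖u‖ < R}))`.  Files: K `sheet_count`, L
  `injOn_shadow_outerPartK` (+ image), O cap immersivity (after the pending J/N), P1 `…ChartCutRegion` (open / connected /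
  closure / frontier / complement of `U_R`), P2 `…ChartCutExterior` (`(closure U_R)ᶜ` connected), Q `…ChartPsi` (structure
  map, lead), R `…ChartInverseExtension` (globally smooth left inverse near a compact set whose complement lies in one
  chart), S the stub.  WAVE 1 (now): P1, P2, R (+ O, K as J/N land); lead: Q and S.  Stubs: F1 | S3'' | O1 | S4''σ.
  Sorries: 4.
LEAD LOG (line lead seat c5, prover-line-stmt-SmoothPoincare4-7844-c5-0, complementary from 2026-08-16T21:40Z beside seat c4;
registry inherited at 2026-08-16T23:20Z after c4 fell silent at the gate at 21:31:40Z with files Q `…ChartPsi` p127094, R `…ChartInverseExtension`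
p127119, P2 `…ChartCutExterior` p127138 landed and P1's five `liftedCut` helpers registered but no P1 file; PICKED.md).
* r9 (this revision).  O1 IS A THEOREM — WITHOUT DEGREE THEORY.  The side lemma `stub_outerSideLemma : OuterSideLemma`, filed by
  r7/r8 as a degree-theory debt (normal degree of immersed `S³ ↬ ℝ⁴`, Hopf's `deg Gauss = χ`), is proved in the tree by a
  COVERING argument (paper: `Cruxes/OrigamiFoldExistence/SideLemma-covering-c5.md`): let `T` be the side of the lifted crease
  `C' = λ(c_out)` into which the structure map `Ψ = psiMap ι δ C` (file Q) lifts the thin outer collar (first-order collar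
  package with free sign, `exists_collarSide`, p127729); if `T` were the chimney, `Ψ` restricted to the compact
  `K = M ∖ e₀(B₂)` — continuous, and a local homeomorphism over `Ψ⁻¹(chimney)` (`isLocalHomeomorphOn_restrict_psiMap`,
  p127752) — would be a COVERING over the chimney (Mathlib `IsCoveringMapOn.of_isLocalHomeomorphOn`), the chimney is an open
  4-cell by BROWN's generalized Schoenflies theorem (PROVED in the tree: `SchoenfliesBrown/Flat/Separation`; packaged as
  `Literature/Topology/FourManifolds/SphereHypersurfaceSidesSimplyConnected.lean`, p127777), so the lifting criterion
  (`CoveringSpaces.exists_lift_isOpen_range`) gives a sheet through the collar (`exists_sheet_of_collar_chimney`,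
  `…StubOuterSideLemmaSheet`, p128196) whose union with the closed chart ball is clopen, nonempty and misses the round point
  over the north pole — contradicting connectedness of `M` (`liftS4_chartShadow_mem_exterior`, `outerSideLemma_of_capMaps`,
  `outerSideLemma_of_capImmersive`, `…StubOuterSideLemma`, p128530); the unbounded connected `W` of the statement is
  `λ⁻¹(exterior)` (`exists_W_of_mem_exterior`, p127762).  The only input beyond the tree is the cap map: file N `capMap δ`
  (p125831, LANDED: smooth where `p₄ < 1`, `= λ ∘ proj5` on the band, cap onto `S⁴ ∖ λ(B_ρ)`) and its IMMERSIVITY on the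
  cap (file O′ `eq_zero_of_mfderiv_capMap_eq_zero`, `…StubOuterSideLemmaCapImmersive`, p128297, LANDED — so
  `theorem stub_outerSideLemma : OuterSideLemma` is a TREE THEOREM, p128530).  RESHAPE (names only): O1 leaves the stub list — the name `stub_outerSideLemma` below now denotes
  the tree theorem and `OrigamiFoldExistence_of` takes it no more as a hypothesis; F1, S3'', S4''σ byte-identical.  By the same covering
  method the structure map is INJECTIVE on `K = M ∖ e₀(B₂)` with image `(chimney)ᶜ` (`psiMap_injOn_and_image`, `injOn_and_image_psiMap_capMap`,
  file Σ `…StubOuterCleanRecognitionOfSidePsiCover`, ready — lands when p128530 is built on the farm), which SUPERSEDES the sheet-count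
  files J/K/L of the chart worker for the purposes of S4''σ.  Consequence for S4''σ: `CollarData D`
  is now inhabited unconditionally (`nonempty_collarData` fed with O1), so files K `sheet_count`, L `injOn_shadow_outerPartK`,
  P1 (`liftedCut`: `compl_/isOpen_/isConnected_/compl_closure_/frontier_liftedCut`, registered by c4's worker 21:31Z) and the
  assembly S are unconditional constructions; WAVE of this cycle: P1 (worker, in flight); lead: Σ and S.
  Stubs: F1 (literature debt) | S3'' (OPEN) | S4''σ (TRUE, in flight).  Sorries: 3.
* r10 (seat c5, 22:25Z; registered by seat c6).  S4''σ IS A TREE THEOREM: `stub_outerCleanRecognitionOfSide` LANDED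
  (`…StubOuterCleanRecognitionOfSide.lean`, p129050: the cut-at-`R` assembly over Σ `…OfSidePsiCover` p128766, P1 `…ChartCutRegion`
  p128810, P2 p127138, R p127119 and the glue p118158).  RESHAPE (names only): S4''σ leaves the stub list — the name below denotes the
  tree theorem and `OrigamiFoldExistence_of` takes it no more as a hypothesis; F1 and S3'' byte-identical.
  Stubs: F1 `stub_eliashbergMishachev2009` (literature debt: E–M 2009 Thm 3.2, theorem in print) | S3'' `stub_outerNormalisation` (OPEN).
  Sorries: 2.  The line's KERNEL ENDPOINT is therefore  `E ⇐ F1 ∧ S3'' ∧ Schoenflies ∧ Γ₄ = 0 ∧ EmbedsInR5 ∧ RS`,  every other rung a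
  tree theorem.
LEAD LOG (line lead seat c6, prover-line-stmt-SmoothPoincare4-7844-c6-0, registry inherited 2026-08-16T22:45Z; PICKED.md).
* r10 registered and published (commit fb5dacf2c7c4).  This seat LANDED the endpoint itself as a Theorems file
  (`…ShadowPleatsReduction.lean`, p129858 ACCEPTED, axioms standard:
  `SmoothPoincare4 ⇐ EmbedsInR5 ∧ F1 ∧ OuterNormalisation ∧ Schoenflies ∧ Γ₄=0`, the crux from the same `∧ RS`, and the
  SCHOENFLIES-FREE reformulation `SmoothPoincare4 ⟺ N₁` modulo F1/`EmbedsInR5`, N₁ := clean normalisation to `≤ 1` chart, over the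
  landed clean rung S5a + S6), and records the verdict on S3'': relative to the line's standing inputs it is SPC4-equivalent
  (`stub_outerNormalisation_of_smoothPoincare4` / the Reduction) and implies the punctured-embedding crux (A) of route SchoenfliesSplit
  outright, so at r5–r10 the line is weakly dominated by the folklore factorisation `SPC4 ⇐ A ∧ Schoenflies ∧ Γ₄=0` — crux-sized:
  `promote-stub` (see PICKED.md seat c6 and `Cruxes/OrigamiFoldExistence/Endpoint-analysis-c6.md`).  Tree names of the endpoint:
  `…Theorems.OrigamiFoldExistence.ShadowPleats.{smoothPoincare4_of_outerNormalisation, origamiFoldExistence_of_outerNormalisation,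
  smoothPoincare4_of_cleanNormalisation, origamiFoldExistence_of_cleanNormalisation, cleanNormalisation_of_smoothPoincare4,
  smoothPoincare4_iff_cleanNormalisation, smoothPoincare4_iff_outerNormalisation, outerNormalisation_of_cleanNormalisation}`.
  wave: none (the two open stubs are a literature debt and an open problem).
-/

noncomputable section

-- the prescribed namespace `Summit.<P>.<Sub>.…` duplicates `SmoothPoincare4` (P = Sub)
set_option linter.dupNamespace false

open scoped Manifold ContDiff Topology
open Set Function TopologicalSpace ContinuousMap
open Literature.Topology.FourManifolds (HomotopySphere)
open Summit.SmoothPoincare4.SmoothPoincare4.Theses.SymplecticOrigami (OrigamiFoldExistence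
  RoundSphereIsOrigamiFold)
open Summit.SmoothPoincare4.SmoothPoincare4.Theorems.OrigamiFoldExistence (Negative.foldData_transport)
open Summit.SmoothPoincare4.SmoothPoincare4.Theorems.OrigamiFoldExistence.ShadowPleats

namespace Summit.SmoothPoincare4.SmoothPoincare4.Cruxes.OrigamiFoldExistence.ShadowPleats

/-- Local notation: the model space `ℝ⁴ = ℂ²` (coordinates `p 0, …, p 3`). -/
local notation "E4" => EuclideanSpace ℝ (Fin 4)

/-- Local notation: `ℝ⁵ = ℂ² × ℝ`, height coordinate `p 4`. -/
local notation "E5" => EuclideanSpace ℝ (Fin 5)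

/-- Local notation: the round 4-sphere with Mathlib's smooth structure. -/
local notation "𝕊⁴" => (Metric.sphere (0 : EuclideanSpace ℝ (Fin 5)) 1)

/-! ### Vocabulary
`proj5`, `pleatSpheres`, `IsFoldPointAt`, `IsPleatedPosition`, `HasPleatedPosition` are the TREE definitions of
`Summits/SmoothPoincare4/SmoothPoincare4/Theorems/SymplecticOrigamiOrigamiFoldExistenceShadowPleatsDefs.lean`
(namespace `Summit.SmoothPoincare4.SmoothPoincare4.Theorems.OrigamiFoldExistence.ShadowPleats`, opened above;
bodies verbatim the planner's). -/

/-! ### The stub STATEMENTS (named `Prop`s; the registered `stub_*` theorems below restate them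
verbatim, and `Registered.stub_*` are their name-keyed aliases used as the hypotheses of
`OrigamiFoldExistence_of` — same device as `Lines/round-trace-continuity.lean`) -/

/-! STUB 1 [Σ ↪ ℝ⁵] is the route item
`Summit.SmoothPoincare4.SmoothPoincare4.Theses.AlgebraicDegree.EmbedsInR5` (stmt-SmoothPoincare4-3403) BY NAME —
no local statement, no local stub. -/

/-- Statement of STUB 2 [ROUND-RIM NORMAL FORM, Eliashberg–Mishachev]: an embedded homotopy
4-sphere in `ℝ⁵` can be re-embedded in pleated round-rim position.  From r4 on DISCHARGED modulo three named
Literature facts (`roundRimNormalForm_of_facts`). -/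
def RoundRimNormalForm : Prop :=
  ∀ (M : Type) [TopologicalSpace M] [T2Space M] [SecondCountableTopology M] [ChartedSpace E4 M]
    [IsManifold (𝓡 4) ∞ M] (ι₀ : M → E5), M ≃ₕ 𝕊⁴ →
    Manifold.IsSmoothEmbedding (𝓡 4) (𝓡 5) ∞ ι₀ → ∃ k, HasPleatedPosition M k

/-- Statement of STUB 3'' [OUTER NORMALISATION, r5; hardest; slack NOT provably zero]: every pleated round-rim
position of a homotopy 4-sphere can be replaced by an un-nested position with at most one chart whose OUTER crease is
embedded. -/
def OuterNormalisation : Prop :=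
  ∀ (M : Type) [TopologicalSpace M] [T2Space M] [SecondCountableTopology M] [ChartedSpace E4 M]
    [IsManifold (𝓡 4) ∞ M], M ≃ₕ 𝕊⁴ →
    ∀ k, HasPleatedPosition M k → ∃ k', k' ≤ 1 ∧ HasOuterCleanPleatedPosition M k'

/-- Statement of STUB 4'' [OUTER-CLEAN RECOGNITION, r5; TRUE on paper — the lead's theorem O2/O3 — modulo the two
route items it names: smooth 4-dimensional Schoenflies (`EuclideanOrigami.Schoenflies`, stmt-SmoothPoincare4-10753, OPEN)
and Cerf's `Γ₄ = 0` (`SymplecticOrigami.CerfGammaFour`, formal debt)]. -/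
def OuterCleanRecognition : Prop :=
  Summit.SmoothPoincare4.SmoothPoincare4.Theses.EuclideanOrigami.Schoenflies →
  Summit.SmoothPoincare4.SmoothPoincare4.Theses.SymplecticOrigami.CerfGammaFour →
  ∀ (M : Type) [TopologicalSpace M] [T2Space M] [SecondCountableTopology M] [ChartedSpace E4 M]
    [IsManifold (𝓡 4) ∞ M], M ≃ₕ 𝕊⁴ →
    HasOuterCleanPleatedPosition M 1 → Nonempty (M ≃ₘ⟮𝓡 4, 𝓡 4⟯ 𝕊⁴)

/-- Statement of STUB 5a [CLEAN ONE-PLEAT IRONING, r3; TRUE on paper]: a CLEAN 1-pleat position irons out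
(Disproof §7c (γ)+(γ'); c2 R5; Theorem C at `k = 1`). -/
def CleanOnePleatIroning : Prop :=
  ∀ (M : Type) [TopologicalSpace M] [T2Space M] [SecondCountableTopology M] [ChartedSpace E4 M]
    [IsManifold (𝓡 4) ∞ M], M ≃ₕ 𝕊⁴ →
    HasCleanPleatedPosition M 1 → HasPleatedPosition M 0

/-- Statement of STUB 6 [PLEAT-FREE ⇒ STANDARD]: `p = 0 ⇒ Σ ≅ S⁴`.  From r4 on a TREE THEOREM
(`…Theorems.OrigamiFoldExistence.ShadowPleats.stub_pleatFreeStandard`, p107118). -/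
def PleatFreeStandard : Prop :=
  ∀ (M : Type) [TopologicalSpace M] [T2Space M] [SecondCountableTopology M] [ChartedSpace E4 M]
    [IsManifold (𝓡 4) ∞ M], M ≃ₕ 𝕊⁴ →
    HasPleatedPosition M 0 → Nonempty (M ≃ₘ⟮𝓡 4, 𝓡 4⟯ 𝕊⁴)

/-! ### Discharged rungs (no `sorry`) -/

/-- STUB 2 DISCHARGED modulo three named Literature facts (S2 worker of seat c3, tree file
`…StubRoundRimNormalForm.lean`, p107172): Kosinski's round lower part, Hopf's relative Gauss degree
`χ/2 − 1 = 0` on a homotopy 4-sphere, and Eliashberg–Mishachev's Theorem 3.2 in its double-fold, relative,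
`C⁰`-small form for the vertical line foliation of `ℝ⁵`; the glue identifies the Literature vocabulary
(`shadowProj`, `doubleFoldSpheres`, `IsWhitneyFoldAt`) with the line's (`proj5`, `pleatSpheres`,
`IsFoldPointAt`) by `rfl` and cuts the round part of the new embedding at `1 - δ`. -/
theorem roundRimNormalForm_of_facts
    (hEM : Literature.Topology.Immersions.EliashbergMishachev2009_doubleFolds_of_hasTransversalRotation)
    (hRP : Literature.Topology.Immersions.exists_isSmoothEmbedding_roundPart)
    (hTR : Literature.Topology.Immersions.hasTransversalRotation_of_homotopyEquiv_sphere_four) :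
    RoundRimNormalForm :=
  stub_roundRimNormalForm_of_facts hEM hRP hTR

/-- Statement of the LITERATURE DEBT of STUB 2 (r5): the conjunction of the three named Literature facts of
`Literature/Topology/Immersions/WrinkledEmbeddingsRoundCollar.lean` (p98391) — Eliashberg–Mishachev 2009 Thm 3.2
(double-fold, relative, `C⁰`-small, vertical foliation of `ℝ⁵`), Kosinski's round lower part, Hopf's relative Gauss
degree on a homotopy 4-sphere.  The skeleton check admits as hypotheses of `OrigamiFoldExistence_of` only registered
obligations and declared stubs BY NAME, so the three facts enter through this one named stub (the device of
`Lines/round-trace-continuity.lean`'s `stub_lawsonMichelsohn1984`): it is closed the day the Literature discharges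
the facts (`…_holds`), not by this line. -/
def WrinkledEmbeddingFacts : Prop :=
  Literature.Topology.Immersions.EliashbergMishachev2009_doubleFolds_of_hasTransversalRotation ∧
  Literature.Topology.Immersions.exists_isSmoothEmbedding_roundPart ∧
  Literature.Topology.Immersions.hasTransversalRotation_of_homotopyEquiv_sphere_four

/-- STUB 2 from the literature debt, packaged. -/
theorem roundRimNormalForm_of_wrinkledEmbeddingFacts (h : WrinkledEmbeddingFacts) : RoundRimNormalForm :=
  roundRimNormalForm_of_facts h.1 h.2.1 h.2.2

/-- STUB 6 is the tree theorem `stub_pleatFreeStandard` (S6 worker of seat c3, p107118, over seat 1's files I–III):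
the statement `PleatFreeStandard` holds outright. -/
theorem pleatFreeStandard_holds : PleatFreeStandard := stub_pleatFreeStandard

/-! ### The registered stubs (r10: two — F1 literature debt; S3'' open) -/

/-- STUB F1 [LITERATURE DEBT of the round-rim normal form: Eliashberg–Mishachev's double-fold h-principle] (r6;
THEOREM IN PRINT, XL to formalise).  Of the three named facts discharging S2 (`stub_roundRimNormalForm_of_facts`,
p107172), F2 (Kosinski's round lower part) is the tree theorem `exists_isSmoothEmbedding_roundPart_holds` and F3 (Hopf:
relative Gauss degree `χ/2 − 1 = 0`) the tree theorem `hasTransversalRotation_of_homotopyEquiv_sphere_four_holds`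
(`Literature/Topology/Immersions/GaussMapDegreeEuler.lean`, with Hopf's degree theorem
`homotopic_of_hasDegree_of_homotopyEquiv` and the curvatura integra `two_mul_degree_gauss_eq_relEuler`); what is left
is F1 = `EliashbergMishachev2009_doubleFolds_of_hasTransversalRotation` — Eliashberg–Mishachev, *Wrinkled embeddings*
(Contemp. Math. 498, 2009 = arXiv:1108.1265) Thm 3.2 with Remarks 1–2 and the final Remark of §3.2 (double folds via
Thm 2.10), for a closed hypersurface of `ℝ⁵` with round lower part and the vertical line foliation — itself reduced in
the tree to the bare ENGINE (Thm 2.10 relative + §2.3 B in Gauss-map form: `EliashbergMishachev2009_doubleFolds_of_engine`,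
`…WrinkledEmbeddingsRoundCollarProofs.lean` §10).  Not a task of this line: it closes when the Literature proves
`…_holds` (wrinkling along a fine triangulation, holonomic approximation over the 3-skeleton, goffering, cusp surgery,
regularisation).  Statement audited by the S2-facts worker (wave 2): no defect; `IsWhitneyFoldAt` does not force
corank 1, which only weakens F1.  Sources: EliashbergMishachev2009; Eliashberg1972; Spring2005.  Size: XL (debt). -/
theorem stub_eliashbergMishachev2009 :
    Literature.Topology.Immersions.EliashbergMishachev2009_doubleFolds_of_hasTransversalRotation := by
  sorry

/-- The literature debt F1 gives all three facts (F2, F3 are tree theorems). -/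
theorem wrinkledEmbeddingFacts_of_eliashbergMishachev2009
    (h : Literature.Topology.Immersions.EliashbergMishachev2009_doubleFolds_of_hasTransversalRotation) :
    WrinkledEmbeddingFacts :=
  Literature.Topology.Immersions.wrinkledEmbeddingFacts_of_doubleFolds_of_hasTransversalRotation h
    Literature.Topology.Immersions.hasTransversalRotation_of_homotopyEquiv_sphere_four_holds

/-- STUB 3'' [OUTER NORMALISATION] — HARDEST, the line's open stub from r5 on, and the FIRST stub of this line whose
slack is not provably zero.  Every pleated round-rim position of a homotopy 4-sphere `M` (any number of charts, wild
and nested charts allowed) can be replaced by a position of `M` with at most ONE chart, un-nested (vacuous for `k' ≤ 1`),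
whose OUTER crease `c_out = proj5 ∘ ι ∘ e (S(0,2))` is an EMBEDDED 3-sphere of `ℝ⁴` — inner crease, hole and annulus
unrestricted (`HasOuterCleanPleatedPosition`, `…ShadowPleatsOuterCleanDefs.lean`).
SLACK (paper, `OuterClean-analysis-c3.md` §5): `SmoothPoincare4 ⇒` this stub (transport of the round sphere's 0-chart
position; kernel certificate to be landed next to p113474 once the vocabulary file lands); this stub `⇒` the
punctured-embedding cruxes `EuclideanOrigami.PuncturedEmbeds` (stmt-7485) / `SchoenfliesSplit.SchsplitPuncturedEmbeds`
(stmt-0371) for every homotopy 4-sphere (O3b: the punctured `M` is the Schoenflies ball `S⁴ ∖ U_out`); this stub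
`∧ Schoenflies ∧ Γ₄=0 ⇒ SmoothPoincare4` (S4'').  So SPC4 factors inside the line as OUTER-NORM ∧ SCHOENFLIES, and the
stub is SPC4-equivalent ONLY IF Schoenflies spheres `X ∪ B⁴` always admit outer-clean 1-pleat positions — the
REALISABILITY question (R) (analysis note §6: an immersion-of-the-shell problem `S³×[1,2] → ℝ⁴` rel both end germs,
i.e. a MONOTONE regular homotopy from the reflected boundary of an immersed standard ball to the outer collar of
`∂U`, where no h-principle applies, plus a lifting problem), handed to the disprover.
MECHANISM (what a proof must do): starting from E–M's nested, threaded output (S2), (i) UN-NEST (transplant inner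
blocks across parent sheets, c2 7.5 (b)); (ii) MERGE / DELETE down to one chart (c2 7.5 merging along corridors;
Disproof (γ) deletion of clean innermost unthreaded charts); (iii) UN-SELF-THREAD THE OUTER CREASE ONLY: make
`c_out` embedded by retreats/advances of the outer lip (c2 §6.7 retreat calculus; (P3): a `c_out`-slab is threaded
only by `c_in`-pairs), leaving the inner crease wild.  Step (iii) is strictly less than cleaning (O3a: what is left
after it is a Schoenflies ball, not `S⁴`).
BENCHES: `N = (S²×S²)#(S¹×S³)` and Kervaire's `M_K` admit pleated positions (E–M) but NO un-nested outer-clean position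
for any `k` (O2's output `(S⁴ ∖ ⋃U) ∪ balls` is simply connected; for `N` also `b₂ = 0` fails) — every proposed
un-nesting / outer-unthreading calculus must fail on them, and a `π₁`-blind one is refuted by `M_K` (Disproof §7b).
Why it might fail: through (R) — if realisability holds, the stub is SPC4-equivalent and an exotic `S⁴` refutes it;
independently of (R), an exotic `Σ` with `Σ° ⊄ S⁴` (failure of `PuncturedEmbeds`) refutes it.  Sources:
OuterClean-analysis-c3.md (lead, seat c3); W-Morse-analysis-c2.md §§6–7; stub_twoPleatUnthreading.md (S4 worker:
Theorem C, merging); Disproof.lean v6.1 §7b/§7c; EliashbergMishachev2009 §2.10; Mazur1959 / Kirby1989 (Schoenflies);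
BudneyGabai2019.  Size: open-problem (slack ≤ Schoenflies). -/
theorem stub_outerNormalisation :
    ∀ (M : Type) [TopologicalSpace M] [T2Space M] [SecondCountableTopology M]
      [ChartedSpace (EuclideanSpace ℝ (Fin 4)) M] [IsManifold (𝓡 4) ∞ M],
      M ≃ₕ (Metric.sphere (0 : EuclideanSpace ℝ (Fin 5)) 1) →
      ∀ k, HasPleatedPosition M k → ∃ k', k' ≤ 1 ∧ HasOuterCleanPleatedPosition M k' := by
  sorry

/-! ### STUB 4''-CHART [OUTER-CLEAN RECOGNITION, its ONE geometric ingredient] (r6 text kept; S4'' itself is the TREE reduction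
`outerCleanRecognition_of_chart` of this ingredient, p120886, through the S4'' worker's glue p118158; TRUE ON PAPER — the lead's theorem, `OuterClean-analysis-c3.md` §§2–4 —
with the two classical open/unformalised inputs taken as the route items they already are: smooth 4-dimensional
SCHOENFLIES in equator form (`EuclideanOrigami.Schoenflies`, stmt-SmoothPoincare4-10753 = `SchsplitSchoenflies`
stmt-0372 = `Literature.Topology.FourManifolds.SmoothSchoenfliesConjectureFour`; ball form ↔ equator form is the tree's
`smoothSchoenfliesConjectureFour_iff_ballForm`) and CERF `Γ₄ = 0` (`SymplecticOrigami.CerfGammaFour`,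
stmt-level formal debt of this very route).  A homotopy 4-sphere with an OUTER-CLEAN 1-pleat round-rim position is
diffeomorphic to `S⁴`.  PROOF.  (O1) SIDE LEMMA: the chart is innermost (`k = 1`), its outer crease
`c_out : θ ↦ g(e(2θ))` (`g = proj5 ∘ ι`) is an embedded `S³ ⊂ ℝ⁴` bounding the compact region `Ū = Ū_out` (`χ(Ū) = 1`);
the shell `{1 < |u| < 2}` and the hole are fold-free, the creases immersed (`eq_zero_of_fderiv_chartShadow_eq_zero`,
p108609), so `s ↦ g(e(s·))`, `s ∈ [1,2]`, is a REGULAR HOMOTOPY from `c_in` to `c_out`, along which the normal degree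
`deg n_s` (unit normal fixed by the orientations) is constant; at `s = 1`, Whitney's even-function reparametrisation
makes `g∘e|B̄₁` an immersed closed 4-ball of orientation character `χ_Q`, whose boundary Gauss map has degree `χ_Q`
(Hopf for immersed balls); at `s = 2`, `deg n₂ = χ(Ū)·d₂ = d₂`, `d₂ = ±1` the degree of `c_out : S³ → ∂Ū` (Hopf for
`∂Ū`); so `d₂ = χ_Q`; but the collar `{2−η < |u| ≤ 2}` maps with character `−χ_Q` onto the one-sided collar `K` of
`c_out` on the TWO-SHEET side `T`, giving `d₂ = −(−χ_Q) = χ_Q` if `T` is the unbounded side (boundary orientations of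
`K` and `Ū` opposite) and `d₂ = −χ_Q` if `T = U` — contradiction in the second case: THE TWO GERMS BORN AT `c_out` LIE
OUTSIDE `U`.  (O2) STRUCTURE: degree theory for the proper local diffeomorphism `g` on the outer sheet `P̄⁺`
(boundary `E ⊔ S₂`) gives `n_P = 1_B − w₂`, and by (O1) `w₂ = +1_U`: `n_P = 1_B − 1_U ≥ 0`, hence `U ⋐ B_ρ` (`n_P ≥ 1`
on the band annulus; touching `∂B_ρ` would double-cover nearby points), `n_P ≤ 1`, `g|P̄⁺` a homeomorphism onto
`Π = B̄ ∖ U` (diffeomorphism after Whitney collars at `E`, `S₂`), and `M = P̄⁺ ∪ b̄ ∪ e(B̄₂) ≅ Π ∪ D_∞ ∪ B̄⁴ = X ∪_φ B̄⁴`,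
`X := S⁴ ∖ U` a SCHOENFLIES BALL, `φ(θ) = g(e(2θ))`.  (O3) Schoenflies (equator form ⇒ ball form) makes `Ū`, hence
`X = S⁴ ∖` (open smooth 4-disc) (Palais), a smooth 4-ball, so `M = B̄⁴ ∪_φ B̄⁴` is a twisted sphere
(`Literature.Topology.FourManifolds.TwistedSphere`), and `CerfGammaFour` gives `M ≅ S⁴`.  ∎  Remarks: no homotopy
hypothesis on `M` is used (kept for uniformity: it supplies compactness); conversely `M ≅ S⁴ ⇒ Ū ≅ B̄⁴` (Palais), so at
`k = 1` the Schoenflies input is consumed exactly; with BOTH creases embedded (clean chart) `Ū = g(Q̄) ∖` (external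
collar) is standard for free and neither input is needed (Theorem C / S5a).  Why it might fail: on paper it cannot;
formally it needs Jordan–Brouwer sides for `c_out` (`JordanBrouwerClosedHypersurface`), degree / sheet counting for
proper local homeomorphisms (`ProperLocalHomeomorph`, `exists_seamSheet` p108972), Whitney collars, the assembly of a
diffeomorphism from pieces (`CollarUniquenessBall`, `EuclideanIsotopyExtension`), and the passage equator-form
Schoenflies → ball containing `U` (`SmoothSchoenfliesConjectureFour.exists_ball_not_mem` pattern of
`EuclideanOrigami.SchoenfliesGlue`) — XL, but the same toolkit as the S5a roadmap (`CleanPleatIroningChart`).  Sources: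
OuterClean-analysis-c3.md §§2–4 (lead, seat c3); stub_twoPleatUnthreading.md §5 (Theorem C (C2)–(C5));
W-Morse-analysis-c2.md 4.3; Hopf1927 (`deg G = χ`); Smale1959 (regular homotopy); Whitney1943 (even functions);
Palais1960; Cerf1968; Mazur1959.  Size: M (math, done) / XL (Lean).
From r7 on this statement is no longer ONE registered stub: it is SPLIT into the side lemma O1 (`stub_outerSideLemma`)
and (r7) the construction given O1; from r8 on the construction targets S4'' directly (`stub_outerCleanRecognitionOfSide`,
cut at radius `R` inside the fold-free collar) and this radius-`2` ingredient is off the line's path (still TRUE; see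
`outerCleanRecognition_of_chart''`). -/

/-- O1 [THE SIDE LEMMA] is a TREE THEOREM from r9 on (`…Theorems.OrigamiFoldExistence.ShadowPleats.stub_outerSideLemma`,
p128530, seat c5): for a `1`-chart pleated round-rim position of a homotopy `4`-sphere with OUTER-CLEAN chart the two germs born
at the outer crease lie on its UNBOUNDED side.  Proved WITHOUT degree theory: coverings (`Ψ|K → chimney`, Mathlib
`IsCoveringMapOn.of_isLocalHomeomorphOn`), Brown's generalized Schoenflies theorem (tree), the lifting criterion, and a
clopen argument (`Cruxes/OrigamiFoldExistence/SideLemma-covering-c5.md`).  The registered name, by the tree theorem. -/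
theorem outerSideLemma_holds : OuterSideLemma := stub_outerSideLemma

/-- S4''σ [OUTER-CLEAN RECOGNITION GIVEN THE SIDE LEMMA] is a TREE THEOREM from r10 on
(`…Theorems.OrigamiFoldExistence.ShadowPleats.stub_outerCleanRecognitionOfSide`, p129050, seat c5; r8 text kept).  Given O1, OUTER-CLEAN
RECOGNITION (S4'' verbatim: `Schoenflies → CerfGammaFour → ∀ M ≃ₕ S⁴, HasOuterCleanPleatedPosition M 1 → M ≅ S⁴`).
WHY NOT `OuterCleanRecognitionChart` (r6/r7): that ingredient asks for a smooth immersion `Φ : S⁴ → M` ACROSS the lifted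
OUTER CREASE `λ(c_out)`, where the structure map `Ψ = λ ∘ shadow` FOLDS — its inverse is continuous but not smooth there,
and repairing it needs a fibrewise re-parametrisation of the fold collar in straightened tube coordinates (r7 log, step 4).
The glue `nonempty_diffeomorph_of_chartComplement` (p118158) is GENERIC in the chart and the crease, so this stub CUTS
INSTEAD AT RADIUS `R ∈ (2 + κ/2, 2 + κ)` INSIDE THE FOLD-FREE THIN COLLAR: with the rescaled chart `e_R = e 0 ∘ (R/2 ·)` the
"crease" is the EMBEDDED, IMMERSED sphere `G(S_R)` (thin-collar injectivity `CollarData.injOn`, immersivity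
`CollarData.immersive`, files E–F), across which `Ψ` is a local diffeomorphism, and the fold crease `c_out` disappears
inside the lifted cut region.  CONSTRUCTION.  (1) SHEET COUNT (files G–L, c3's worker; J `…Claim` p124679 pending, K
`sheet_count`, L `injOn_shadow_outerPartK` registered): `n_P = 1_{B_ρ} − 1_{U₄}` off `S_ρ ∪ c_out` for the outer part
`P⁺ = {h > 1 − δ} ∖ e 0 (B̄₂)`, whence the shadow is INJECTIVE on `P̄⁺ = {h ≥ 1 − δ} ∖ e 0 (B₂)` with image `B̄_ρ ∖ U₄`
(`U₄ = λ⁻¹(chimney)`), `U₄ ⊂ B_ρ`, and points of `P̄⁺` strictly above the plane cast shadows of norm `< ρ`.  (2) CAP (files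
M–O; N `…CapMap` p125831 pending): the cap map is smooth where `p₄ < 1`, equals `λ ∘ proj5` on the band
`{(1 − δ)/2 ≤ p₄ < 1}` of the round sphere, is injective on the cap `{‖p‖ = 1, p₄ ≤ 1 − δ}` with image `S⁴ ∖ λ(B_ρ)`, and
its differential is injective on tangent directions there (O, in the `ℝ⁵`-calculus form: `w ⊥ p`, `w ≠ 0 ⇒ d(capMap)_p w ≠ 0`).
(3) CUT REGION (file P1 `…ChartCutRegion`): `U_R := chimney ∪ λ(G({2 ≤ ‖u‖ < R}))` is OPEN (local surjectivity of the collar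
onto the exterior side of the tube, `CollarData.localSurj`, needs `R > 2 + κ/2`; `G` is an open map on the open collar),
CONNECTED, with `closure U_R = closure(chimney) ∪ λ(G({2 ≤ ‖u‖ ≤ R}))`, `frontier U_R = λ(G(S_R))`,
`U_Rᶜ = exterior ∖ λ(G({2 < ‖u‖ < R}))`; (file P2 `…ChartCutExterior`) `(closure U_R)ᶜ = exterior ∖ λ(G({2 < ‖u‖ ≤ R}))` is
CONNECTED (a separation would split off the connected open collar piece `λ(G({R < ‖u‖ < 2 + κ}))`; the other piece is then
clopen in the connected `exterior`, because `λ ∘ G` is an open map on the open collar).  (4) STRUCTURE MAP (file Q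
`…ChartPsi`, lead): `Ψ m := capMap (ι m)` if `h ≤ 1 − δ`, `λ(proj5 (ι m))` otherwise — equal to `λ ∘ proj5 ∘ ι` on the open
`{h > (1 − δ)/2}` and to `capMap ∘ ι` on the open `{h < 1 − δ}`, hence SMOOTH on `M`; on `K_R := M ∖ e 0 (B_R)` it is INJECTIVE
((1) above the plane, (2) below, `λ(B_ρ)` versus its complement in the mixed case plus the seam lemma), IMMERSIVE at every
point of `K_R` (shadow immersive off the fold spheres above the plane and at round points of positive height — the
`h ≤ 1 − δ` half of `injective_mfderiv_shadow_of_pos`; `λ` immersive; (2) below the plane through `range dι ⊥ ι m`,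
`inner_mfderiv_eq_zero`), and `Ψ(K_R) = U_Rᶜ` ((1) + (2) + `U₄ ∪ G([2,R)) ⊂ B_ρ`).  (5) INVERSE (file R
`…ChartInverseExtension`): an injective immersion near the compact `K_R` is injective with bijective differential on an
open `W ⊇ K_R` (Literature `exists_isOpen_injOn_of_isCompact`, Hirsch 2.1.3/Ex. 7), its inverse is smooth on the open
`Ψ(W)` (Literature `contMDiffOn_invFunOn_of_bijective_mfderiv`, Lee 4.5), and since `M ∖ K_R = e 0 (B_R)` lies in ONE chart
a smooth bump function (`exists_smooth_zero_one_of_isClosed`) interpolates it inside the chart to a GLOBALLY smooth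
`Φ : S⁴ → M` with `Φ ∘ Ψ = id` near `K_R`.  (6) GLUE (file S, the stub): `nonempty_diffeomorph_of_chartComplement hS hC`
with `e₀ := e 0 ∘ (R/2 ·)`, `c := λ ∘ G ∘ (R/2 ·)` (`z ↦ c(2z) = λ(G(R z))` is the smooth embedding
`isSmoothEmbedding_liftS4_radialSphere` of the rescaled shadow: injective on `S(0,2)`, immersive there), `U := U_R`, `Φ`.
Why it might fail: on paper it cannot; formal risks are the `mfderiv` bookkeeping on the sphere subtype (pattern S6
`injective_mfderiv_codRestrict_straighten`) and the smoothness of `capMap` as an `S⁴`-valued map (file N).  Sources: files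
A–I, M (tree, c3's worker); Hirsch, *Differential Topology* (1976) Ch. 2 §1, Ch. 4 §5; Lee, *Introduction to Smooth
Manifolds* (2013) Thm. 4.5, Prop. 4.8; OuterClean-analysis-c3.md §3 (O2).  Size: XL (Lean; files K, L, O, P1, P2, Q, R, S). -/
theorem outerCleanRecognitionOfSide_holds : OuterSideLemma → OuterCleanRecognition :=
  stub_outerCleanRecognitionOfSide

/-- STUB 4'' from the tree theorems S4''σ (p129050) and O1 (p128530). -/
theorem outerCleanRecognition_of_stub : OuterCleanRecognition :=
  stub_outerCleanRecognitionOfSide stub_outerSideLemma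

/-- For the record (r6/r7's route, still TRUE, no longer on the line's path): the radius-`2` chart ingredient also gives
S4'', by the tree reduction `outerCleanRecognition_of_chart` (p120886). -/
theorem outerCleanRecognition_of_chart'' (hI : OuterCleanRecognitionChart) : OuterCleanRecognition :=
  outerCleanRecognition_of_chart hI

/-! ### Consistency: each named statement IS its registered stub (definitionally) -/

theorem wrinkledEmbeddingFacts_holds : WrinkledEmbeddingFacts :=
  wrinkledEmbeddingFacts_of_eliashbergMishachev2009 stub_eliashbergMishachev2009
theorem outerNormalisation_holds : OuterNormalisation := stub_outerNormalisation
theorem outerCleanRecognition_holds : OuterCleanRecognition := outerCleanRecognition_of_stub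
/-- S5a: the TREE theorem `stub_cleanOnePleatIroning` (p120755), by name. -/
theorem cleanOnePleatIroning_holds : CleanOnePleatIroning := stub_cleanOnePleatIroning

/-! ### Name-keyed aliases of the open statements (the hypotheses of the composition) -/
namespace Registered

/-- Alias of F1 keyed by the registered stub name. -/
abbrev stub_eliashbergMishachev2009 : Prop :=
  Literature.Topology.Immersions.EliashbergMishachev2009_doubleFolds_of_hasTransversalRotation
/-- Alias of `OuterNormalisation` keyed by the registered stub name. -/
abbrev stub_outerNormalisation : Prop := OuterNormalisation
end Registered

/-! ### Glue (proved) -/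

/-- RECOGNITION of un-nested outer-clean positions with at most one chart: `k = 0` is the tree theorem S6 (no
Schoenflies, no Cerf); `k = 1` is STUB 4'' with the two route items. -/
theorem nonempty_diffeomorph_of_outerClean_le_one (h4 : OuterCleanRecognition)
    (hSch : Summit.SmoothPoincare4.SmoothPoincare4.Theses.EuclideanOrigami.Schoenflies)
    (hCerf : Summit.SmoothPoincare4.SmoothPoincare4.Theses.SymplecticOrigami.CerfGammaFour)
    (M : Type) [TopologicalSpace M] [T2Space M] [SecondCountableTopology M] [ChartedSpace E4 M]
    [IsManifold (𝓡 4) ∞ M] (hM : M ≃ₕ 𝕊⁴) (k : ℕ) (hk : k ≤ 1) (hP : HasOuterCleanPleatedPosition M k) :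
    Nonempty (M ≃ₘ⟮𝓡 4, 𝓡 4⟯ 𝕊⁴) := by
  interval_cases k
  · exact stub_pleatFreeStandard M hM ((hasOuterCleanPleatedPosition_zero_iff M).1 hP)
  · exact h4 hSch hCerf M hM hP

/-- The UNCONDITIONAL clean rung (S5a + S6): a homotopy 4-sphere with a clean 1-chart position is standard, with no
Schoenflies and no Cerf — the witness that those inputs are consumed only by non-clean outer-clean positions. -/
theorem nonempty_diffeomorph_of_clean_one (h5a : CleanOnePleatIroning)
    (M : Type) [TopologicalSpace M] [T2Space M] [SecondCountableTopology M] [ChartedSpace E4 M]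
    [IsManifold (𝓡 4) ∞ M] (hM : M ≃ₕ 𝕊⁴) (hP : HasCleanPleatedPosition M 1) :
    Nonempty (M ≃ₘ⟮𝓡 4, 𝓡 4⟯ 𝕊⁴) :=
  stub_pleatFreeStandard M hM (h5a M hM hP)

/-- The LADDER (r5): embed (STUB 1, route item by name) ⟶ pleated round-rim position (STUB 2, three named facts) ⟶
un-nested OUTER-CLEAN position with at most one chart (STUB 3'', open) ⟶ recognition (S6 | STUB 4'' with
`Schoenflies` and `CerfGammaFour` by name) ⟶ `M ≅ S⁴`, for every `M ≃ₕ S⁴` with the summit's binders. -/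
theorem nonempty_diffeomorph_sphere_of
    (h1 : Summit.SmoothPoincare4.SmoothPoincare4.Theses.AlgebraicDegree.EmbedsInR5)
    (h2 : WrinkledEmbeddingFacts) (h3 : OuterNormalisation) (h4 : OuterCleanRecognition)
    (hSch : Summit.SmoothPoincare4.SmoothPoincare4.Theses.EuclideanOrigami.Schoenflies)
    (hCerf : Summit.SmoothPoincare4.SmoothPoincare4.Theses.SymplecticOrigami.CerfGammaFour)
    (M : Type) [TopologicalSpace M] [T2Space M] [SecondCountableTopology M] [ChartedSpace E4 M]
    [IsManifold (𝓡 4) ∞ M] (hM : M ≃ₕ 𝕊⁴) : Nonempty (M ≃ₘ⟮𝓡 4, 𝓡 4⟯ 𝕊⁴) := by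
  haveI : CompactSpace M :=
    Literature.Topology.FourManifolds.compactSpace_of_homotopyEquiv_sphere_four_holds M hM
  obtain ⟨o⟩ :=
    Literature.Topology.FourManifolds.isOrientable_of_homotopyEquiv_sphere_four_holds M hM
  obtain ⟨ι₀, hι₀⟩ := h1 ⟨M, o, ⟨hM⟩⟩
  obtain ⟨k, hk⟩ := roundRimNormalForm_of_wrinkledEmbeddingFacts h2 M ι₀ hM hι₀
  obtain ⟨k', hk'le, hk'⟩ := h3 M hM k hk
  exact nonempty_diffeomorph_of_outerClean_le_one h4 hSch hCerf M hM k' hk'le hk'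

/-! ### The composition: the registered stubs, the route items `EmbedsInR5` / `Schoenflies` / `CerfGammaFour` /
`RoundSphereIsOrigamiFold` and the three named Literature facts of STUB 2 imply the crux, by name -/

/-- `OrigamiFoldExistence` from the registered stubs (F1 `stub_eliashbergMishachev2009` — literature debt; S3''
`stub_outerNormalisation` — open) and the TREE THEOREMS S4''σ `stub_outerCleanRecognitionOfSide` (r10) and O1
`stub_outerSideLemma` (r9), the route items `EmbedsInR5` (AlgebraicDegree, stmt-SmoothPoincare4-3403),
`Schoenflies` (EuclideanOrigami, stmt-SmoothPoincare4-10753, OPEN: smooth 4-dimensional Schoenflies),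
`CerfGammaFour` (this route, formal debt) and `RoundSphereIsOrigamiFold`, and the three named Literature facts
discharging S2; S6 is the tree theorem `stub_pleatFreeStandard`.  Pure logic + PROVED theorems, no `sorry`: the ladder
gives `M ≅ S⁴` for every `M ≃ₕ S⁴`, and the fold data of `S⁴` transport along the diffeomorphism by the LANDED
`Negative.foldData_transport` (p72874). -/
theorem OrigamiFoldExistence_of
    (h1 : Summit.SmoothPoincare4.SmoothPoincare4.Theses.AlgebraicDegree.EmbedsInR5)
    (h2 : Registered.stub_eliashbergMishachev2009)
    (h3 : Registered.stub_outerNormalisation)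
    (hSch : Summit.SmoothPoincare4.SmoothPoincare4.Theses.EuclideanOrigami.Schoenflies)
    (hCerf : Summit.SmoothPoincare4.SmoothPoincare4.Theses.SymplecticOrigami.CerfGammaFour)
    (hR : RoundSphereIsOrigamiFold) :
    OrigamiFoldExistence := by
  intro M _ _ _ _ _ hM
  obtain ⟨Φ⟩ := nonempty_diffeomorph_sphere_of h1 (wrinkledEmbeddingFacts_of_eliashbergMishachev2009 h2) h3
    outerCleanRecognition_of_stub hSch hCerf M hM
  exact Negative.foldData_transport Φ hR

/-- Wiring check: the two registered stubs and the four route items feed `OrigamiFoldExistence_of`. -/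
example (h1 : Summit.SmoothPoincare4.SmoothPoincare4.Theses.AlgebraicDegree.EmbedsInR5)
    (hEM : Literature.Topology.Immersions.EliashbergMishachev2009_doubleFolds_of_hasTransversalRotation)
    (hSch : Summit.SmoothPoincare4.SmoothPoincare4.Theses.EuclideanOrigami.Schoenflies)
    (hCerf : Summit.SmoothPoincare4.SmoothPoincare4.Theses.SymplecticOrigami.CerfGammaFour)
    (hR : RoundSphereIsOrigamiFold) : OrigamiFoldExistence :=
  OrigamiFoldExistence_of h1 hEM stub_outerNormalisation hSch hCerf hR

/-- The clean rung is unconditional (S5a + S6; both TREE theorems, p120755/p107118). -/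
example (M : Type) [TopologicalSpace M] [T2Space M] [SecondCountableTopology M] [ChartedSpace E4 M]
    [IsManifold (𝓡 4) ∞ M] (hM : M ≃ₕ 𝕊⁴) (hP : HasCleanPleatedPosition M 1) : Nonempty (M ≃ₘ⟮𝓡 4, 𝓡 4⟯ 𝕊⁴) :=
  nonempty_diffeomorph_of_clean_one stub_cleanOnePleatIroning M hM hP

/-! ### Sanity of the vocabulary (NOT stubs, not used in the composition) — tree theorems -/

/-- `k = 0` sanity (the planner's refuter test `RoundSphereIsPleatFree`): the inclusion of the round
sphere is a 0-pleat position — PROVED in the Defs file. -/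
example : HasPleatedPosition 𝕊⁴ 0 := hasPleatedPosition_sphere_zero

/-- … hence (r5) an un-nested OUTER-CLEAN 0-chart position, the `k' = 0` exit of S3''. -/
example : HasOuterCleanPleatedPosition 𝕊⁴ 0 :=
  (hasOuterCleanPleatedPosition_zero_iff _).2 hasPleatedPosition_sphere_zero

/-- Non-vacuity of the fold clause: Whitney's model fold — PROVED in the Defs file. -/
example : IsFoldPointAt ModelFold.modelFold 0 := ModelFold.isFoldPointAt_modelFold

/-- Non-vacuity of the clean vocabulary (S5 worker of seat 1, landed p100895): the radial zig-zag shadow is a clean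
pleat … -/
example : IsCleanPleat (fun u : EuclideanSpace ℝ (Fin 4) => embedL (CleanModel.G u)) id :=
  isCleanPleat_zigzagModel

/-- … and hence OUTER-clean (tree theorem `isOuterCleanPleat_zigzagModel`, p113294). -/
example : IsOuterCleanPleat (fun u : EuclideanSpace ℝ (Fin 4) => embedL (CleanModel.G u)) id :=
  isOuterCleanPleat_zigzagModel

/-- S6 really is closed in the tree (S6 worker of seat c3, p107118): the registered signature, by name. -/
example : PleatFreeStandard := stub_pleatFreeStandard


end Summit.SmoothPoincare4.SmoothPoincare4.Cruxes.OrigamiFoldExistence.ShadowPleats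

end
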